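import Summits.QuantumAdvantage.QuantumAdvantage.Theorems.HintDialDuality
import Summits.QuantumAdvantage.QuantumAdvantage.Theorems.CubicForrelationNearExactIsExactRothausB
import Summits.QuantumAdvantage.QuantumAdvantage.Theorems.CubicForrelationNearExactIsExactMmFormCeilingA
import Summits.QuantumAdvantage.QuantumAdvantage.Theses.QuarticDial

/-!
# Route `QuarticDial`, crux `NearExactIsExactQuartic` (stmt-QuantumAdvantage-26992) — the BC5 RUNG (degree-4 lever)

`NearExactIsExactQuartic` (I4) asserts ISOLATION of the exact Forrelation value on the degree-≤4 slice: `∃ θ < 1`, for all even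
`n` and all `f g` of 𝔽₂-degree `≤ 4`, `Φ(f,g) > θ ⇒ Φ(f,g) = 1`. This file decides I4 on the ONE-SIDED RM(4,n)-PERTURBATION
FAMILY of every exact pair, for ALL `n`, with the sharp constant `θ = 7/8`:

* `forrelation_xor_right_of_isDualOf` — perturbation formula: if `g` is the dual of the bent function `f`
  (`IsDualOf f g`, `Theorems.HintDialDuality`), then `Φ(f, g ⊕ δ) = 2^{-n} Σ_y (−1)^{δ(y)}` (lens-3 g17 node law L7);
* `NearExactIsExactQuartic_rung` — for `δ` of degree `≤ 4`: `Φ(f, g ⊕ δ) = 1 ∨ Φ(f, g ⊕ δ) ≤ 7/8`, by the Reed–Muller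
  minimum weight `wt(δ) ≥ 2^{n−4}` (`bb_rmWeight_holds`, landed) — the kernel isolation floor `1 − 2/2^d` at `d = 4`
  (attained: `δ = y₁y₂y₃y₄`, node law `isolation_floor_four`), so `7/8` is sharp for this family.

Why this is a witness of weakness (D-0033 T3) and not the summit: the statement is finite Walsh/RM(4,n) combinatorics with no
complexity content; the summit restricted to the slice is the route's declared residual `SignedExactQuarticForrelationNotPrBPP`
(open). What it does NOT cover (census T-I4-a, 2026-08-31): TWO-SIDED flips of a Maiorana–McFarland bent/dual pair on 4-flats
reach `Φ = 241/256 > 7/8` at `n = 8` with both functions genuinely quartic and non-bent — so any admissible `θ` in I4 is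
`≥ 241/256`; the rung bounds mechanism (1) only. `fc_sum_signOf_eq_card` is CITED from `…MmFormCeilingA` (not restated).
-/


set_option linter.dupNamespace false -- D-0017: single-problem summit

noncomputable section

namespace Summit.QuantumAdvantage.QuantumAdvantage.Theorems.QuarticDial.NearExactIsExactQuartic

open Finset
open Literature.Computability.QuantumComplexity
open Literature.Computability.QuantumComplexity.DerivativeWalsh (W)
open Summit.QuantumAdvantage.QuantumAdvantage.Theorems.HintDial (IsDualOf)
open Summit.QuantumAdvantage.QuantumAdvantage.Theorems.CubicForrelation.NearExactIsExact (bb_rmWeight_holds fc_sum_signOf_eq_card)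

/-- PERTURBATION FORMULA (lens-3 g17 node law L7, re-proved verbatim): for a bent `f` with dual `g`,
`Φ(f, g ⊕ δ) = 2^{-n} Σ_y (−1)^{δ(y)}`. [cite: Carlet2020, §6.1] -/
theorem forrelation_xor_right_of_isDualOf {n : ℕ} {f g : (Fin n → Bool) → Bool} (h : IsDualOf f g)
    (δ : (Fin n → Bool) → Bool) :
    forrelation f (fun y => xor (g y) (δ y)) = ((2 : ℝ) ^ n)⁻¹ * ∑ y, signOf (δ y) := by
  rw [SgnForrMem.forrelation_eq_sum_W]
  have e : ∀ y : Fin n → Bool,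
      signOf (xor (g y) (δ y)) * W (fun x => signOf (f x)) y = Real.sqrt (2 ^ n) * signOf (δ y) := by
    intro y
    rw [h y, signOf_xor]
    have hs := BuzetChailloux.signOf_sq (g y)
    rw [sq] at hs
    calc signOf (g y) * signOf (δ y) * (Real.sqrt (2 ^ n) * signOf (g y))
        = Real.sqrt (2 ^ n) * signOf (δ y) * (signOf (g y) * signOf (g y)) := by ring
      _ = _ := by rw [hs, mul_one]
  simp_rw [e]
  rw [← Finset.mul_sum, ← mul_assoc, DerivativeWalsh.sqrt_two_pow_three_mul]
  have hs : (0 : ℝ) < Real.sqrt (2 ^ n) := Real.sqrt_pos.2 (by positivity)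
  congr 1
  field_simp

/-- **BC5 RUNG of `NearExactIsExactQuartic`** (all `n`): isolation at `θ = 7/8` on the pairs `(f, g ⊕ δ)`,
`f` bent with dual `g`, `δ` of degree `≤ 4`. -/
theorem NearExactIsExactQuartic_rung :
    ∀ (n : ℕ) (f g δ : (Fin n → Bool) → Bool), IsDualOf f g → IsDegLeFun 4 δ →
      forrelation f (fun y => xor (g y) (δ y)) = 1 ∨ forrelation f (fun y => xor (g y) (δ y)) ≤ 7 / 8 := by
  intro n f g δ hfg hδ
  rw [forrelation_xor_right_of_isDualOf hfg δ, fc_sum_signOf_eq_card]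
  have h2n : (0 : ℝ) < (2 : ℝ) ^ n := by positivity
  by_cases hz : ∃ y, δ y = true
  · right
    have hw := bb_rmWeight_holds n 4 δ hδ hz
    have hw' : ((2 : ℝ) ^ n) ≤ 2 ^ 4 * ((univ.filter fun y => δ y = true).card : ℝ) := by exact_mod_cast hw
    rw [inv_mul_le_iff₀ h2n]
    nlinarith
  · left
    push Not at hz
    have h0 : (univ.filter fun y => δ y = true).card = 0 := by
      rw [Finset.card_eq_zero, Finset.filter_eq_empty_iff]
      intro y _
      simp [hz y]
    rw [h0]
    field_simp
    ring

/-- The rung phrased against the ROUTE ITEM's hypothesis class: on the one-sided perturbation family the conclusion of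
`NearExactIsExactQuartic` holds with `θ = 7/8` (for every `n`, even or not; `f`, `g ⊕ δ` have degree `≤ 4` whenever
`f`, `g` do — at `n = 8` this is every bent pair, Rothaus). -/
theorem nearExactIsExactQuartic_oneSided (n : ℕ) (f g δ : (Fin n → Bool) → Bool) (hfg : IsDualOf f g)
    (hδ : IsDegLeFun 4 δ) (hθ : (7 : ℝ) / 8 < forrelation f (fun y => xor (g y) (δ y))) :
    forrelation f (fun y => xor (g y) (δ y)) = 1 := by
  rcases NearExactIsExactQuartic_rung n f g δ hfg hδ with h | h
  · exact h
  · exact absurd hθ (not_lt.2 h)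

end Summit.QuantumAdvantage.QuantumAdvantage.Theorems.QuarticDial.NearExactIsExactQuartic
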